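/-
Origin: expansion seat `planner-pub-hodgecm-qw8-g11-0`, handover #6 REPLACE (DOC-ONLY) md5 3680e0c7be8acd2be0c17caf2d4b189e (312 l.) SUPERSEDES tree `HodgeCM/Model/Toy/LefModel.lean` 99b1f544 (294 l.): docstrings added to every undocumented theorem/def (CONVENTIONS §3 debt → 0), comment-stripped code IDENTICAL to the tree copy (residue md5 250defdf; no declaration, statement or proof changed); imports unchanged (Mathlib, HodgeCM.Model.Toy.BalMod, HodgeCM.Model. (`HOME/pub-hodgecm-qw8-g11/lean/Qw8g11/LefModel.lean`, md5 3680e0c7, 312 lines);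
landed by the packager successor (mc-unitary-1-g3, gen-8 kit) in gate run 32 REPLACES the earlier landed copy of `HodgeCM/Model/Toy/LefModel.lean` (seat copy carried the packager origin header of the earlier run (stripped)).
-/
-- HANDOVER (planner-pub-hodgecm-qw8-g6-0, unit pub-hodgecm-qw8-g6 (taking over gen 5 WIP)): WIP module `Qw8g6.LefModel`; intended final module
-- `HodgeCM.Model.Toy.LefModel` (kind L5, separating model); rename `import Qw8g6.X` ↦ `import HodgeCM.Model.Toy.X`.
/-
Copyright: pub-hodgecm cell (HodgeCMPerL). Separating-model layer (gens 5–6 of the [QW8] §2.5 lineage).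

# The Lefschetz model `lefModel`

The exterior CM-model `toyModelWith exteriorHodgeData` with a SMALLER space of algebraic classes,

  `Alg^p(X) := Hdg^p(X) ∩ Bal^{2p}(X)`,   `Bal^k(X) := {x | Θ(1 ⊗ x) ∈ balSpan_k(X)}`

(`Obj.balSpan`, `HodgeCM.Model.Toy.LefTypes`: the span of the eigen-wedge-monomials whose Galois-type count is balanced,
`#{j | typ sⱼ = T} = #{j | typ sⱼ = Tᶜ}` for every `T ⊆ Aut_ℚ(Q̄)`), and with ONE MORE CM abelian variety, the
fourfold product `P7 = A_{Φ₀} × A_{Φ₁} × A_{Φ₂} × A_{Φ₃}` of a face of the cyclotomic field `ℚ(ζ₇)`.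

ARCHITECTURE (gen 6). `lefModel := EM.balMod balB C7` is an instance of the GENERIC construction `Universe.balMod`
(`HodgeCM.Model.Toy.BalMod`, abstract universe: all transfers of `ModelAxioms`, N1–N4, F4, F5, F-H0, F7d-B, `Fact_dimProd` are
one-line unfoldings there), so that no heavy elaboration ever sees the toy structure behind `lefModel`; the
model-specific closure properties of `Bal` are proved here at the level of `Obj` / `EM`:
* this file — definitions (`Obj.IsCMObj`, `Obj.balQ`, `balB`, `C7`, `P7`, `lefModel`); top forms and the Hodge star
  preserve balancedness; `Bal` is preserved by pull-back (`bal_pull`), wedge/cup product (`Obj.cup_mem_balQ`,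
  `bal_cup`, `bal_cupAlg`), contains the degree-2 Hodge classes (`bal_lefschetz11` = `Obj.lefschetz11_bal` of
  `HodgeCM.Model.Toy.LefLefschetz`), and is preserved by the M28 Hodge star of a corner product (`starPP_map_balQ`); M17, M26, M28
  for `lefModel` (`lef_cmDominated`, `lef_gysin_surface`, `lef_algDuality`);
* `HodgeCM.Model.Toy.LefDescent` — balanced Gysin descent `bal_descent` (the `B`-half of F7d-B);
* `HodgeCM.Model.Toy.LefModelAxioms` — `lefModel_modelAxioms`, the descent facts, `lefModel_descentFactsB`;
* `HodgeCM.Model.Toy.LefWitness` — `¬ lefModel.HC_CM`, `¬ lefModel.WeilFaceAlgebraic ℚ(ζ₇) f7`, `¬ lefModel.RealisationExistsFace`.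
-/
import Mathlib
import Summits.HodgeConjecture.HodgeCM.Model.Toy.BalMod
import Summits.HodgeConjecture.HodgeCM.Model.Toy.LefLefschetz
import Summits.HodgeConjecture.HodgeCM.Model.Toy.Toy
import Summits.HodgeConjecture.HodgeCM.Model.Toy.ToyGysinDescent
import Summits.HodgeConjecture.HodgeCM.Model.Toy.ToyUnitH0
import Summits.HodgeConjecture.HodgeCM.Model.Toy.CupFacts
import Summits.HodgeConjecture.HodgeCM.Model.Toy.ToyFFacts
import Summits.HodgeConjecture.HodgeCM.Model.Toy.StarAlgDuality
import Summits.HodgeConjecture.HodgeCM.Model.Toy.Isogeny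
import Summits.HodgeConjecture.HodgeCM.Model.Toy.Weil_2
import Summits.HodgeConjecture.HodgeCM.Model.Inhabited
import Summits.HodgeConjecture.HodgeCM.StubTree.Qw8GysinDescentH0

noncomputable section

set_option backward.isDefEq.respectTransparency false

namespace HodgeCM.Toy

open scoped TensorProduct
open exteriorPower Module
open Literature.AlgebraicGeometry.Motives
open Literature.AlgebraicGeometry.Motives.HodgeStructure (ofRat ofRat_apply mem_hodgeClasses_iff)

/-! ### 1. CM objects, rational balanced classes -/

namespace Obj

variable (X : Obj)

/-- every atom carries a complex conjugation (true for CM atoms `(FK K, Φ)`) -/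
def IsCMObj : Prop :=
  ∀ i : X.s.toType, ∃ c : (X.atom i).F →+* (X.atom i).F, ∀ (τ : (X.atom i).F →+* ℂ) (x : (X.atom i).F),
    τ (c x) = starRingEnd ℂ (τ x)

variable {X}

/-- In a CM object the type of the conjugate index `s̄` is the complement of the type of `s`. -/
theorem IsCMObj.typ_bar (h : X.IsCMObj) (s : X.Idx) : X.typ (X.bar s) = (X.typ s)ᶜ := by
  obtain ⟨c, hc⟩ := h s.1
  exact X.typ_bar_of_conj s c hc

/-- Products of CM objects are CM objects. -/
theorem isCMObj_prod {X Y : Obj} (hX : X.IsCMObj) (hY : Y.IsCMObj) : (X.prod Y).IsCMObj := by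
  rintro (i | i)
  · exact hX i
  · exact hY i

/-- The CM atoms `cmObj K Φ` are CM objects (the conjugation is the CM field's complex conjugation
`cF K`). -/
theorem isCMObj_cmObj (K : CMField) (Φ : CMType K) : (cmObj K Φ).IsCMObj := fun _ => ⟨cF K, emb_cF K⟩

/-- The fourfold products `PP K Φ = ∏ᵢ A_{(K, Φᵢ)}` are CM objects. -/
theorem isCMObj_PP (K : CMField) (Φ : Fin 4 → CMType K) : (PP K Φ).IsCMObj := fun j =>
  ⟨Star.cPc K Φ j, Star.emb_cPc K Φ j⟩

variable (X)

/-- **rational balanced classes** `Bal^k(X) = {x ∈ ⋀^k_ℚ L X | Θ (1 ⊗ x) ∈ balSpan_k}` -/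
def balQ (k : ℕ) : Submodule ℚ ↥(⋀[ℚ]^k X.L) :=
  ((X.balSpan k).restrictScalars ℚ).comap
    (((X.Θ k).toLinearMap.restrictScalars ℚ) ∘ₗ TensorProduct.mk ℚ ℂ ↥(⋀[ℚ]^k X.L) 1)

variable {X}

/-- Membership in the rational balanced classes: `x ∈ Bal^k(X)` iff `Θ (ofRat x)` lies in the
balanced span. -/
theorem mem_balQ {k : ℕ} (x : ↥(⋀[ℚ]^k X.L)) : x ∈ X.balQ k ↔ X.Θ k (ofRat x) ∈ X.balSpan k := Iff.rfl

/-- Membership in the rational balanced classes, with `ofRat x` written as the pure tensor `1 ⊗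
x`. -/
theorem mem_balQ' {k : ℕ} (x : ↥(⋀[ℚ]^k X.L)) : x ∈ X.balQ k ↔ X.Θ k ((1 : ℂ) ⊗ₜ[ℚ] x) ∈ X.balSpan k :=
  Iff.rfl

/-- **top forms of a CM object are balanced** (an injective top monomial uses every index, and the whole index
set is balanced since conjugation `s ↦ s̄` flips Galois types to their complements). -/
theorem top_mem_balSpan (h : X.IsCMObj) {k : ℕ} (hk : Fintype.card X.Idx = k) (z : ↥(⋀[ℂ]^k X.LC)) :
    z ∈ X.balSpan k := by
  have hz : z ∈ Submodule.span ℂ (Set.range (X.mono k)) := by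
    rw [X.span_mono_eq_top]; exact Submodule.mem_top
  refine (Submodule.span_le.mpr ?_) hz
  rintro _ ⟨g, rfl⟩
  by_cases hg : Function.Injective g
  · apply X.mono_mem_balSpan
    rw [X.bal_iff_balS g hg]
    have huniv : Finset.univ.image g = Finset.univ := by
      apply Finset.eq_univ_of_card
      rw [Finset.card_image_of_injective _ hg, Finset.card_univ, Fintype.card_fin, hk]
    rw [huniv]
    exact X.balS_univ h.typ_bar
  · rw [X.mono_eq_zero_of_not_injective hg]; exact Submodule.zero_mem _

namespace ConjData

open Set Set.powersetCard

variable (C : X.ConjData) {k l : ℕ} (hV : Module.finrank ℚ X.L = k + l)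

/-- **the Hodge star preserves balancedness** (for a CM object): `⋆_ℂ e_S = c • e_{(S̄)ᶜ}` and `S ↦ (S̄)ᶜ`
preserves balanced index sets. -/
theorem thetaLin_starQ_mem_balSpan (hX : X.IsCMObj) (hlk : l + k = Fintype.card X.Idx)
    {y : ↥(⋀[ℚ]^k X.L)} (hy : X.θ k y ∈ X.balSpan k) : X.θ l (C.starQ hV y) ∈ X.balSpan l := by
  rw [← starC_thetaLin]
  suffices hsub : Submodule.span ℂ ((X.eB.exteriorPower k) '' {S | X.BalS S.val})
      ≤ (X.balSpan l).comap (C.starC hV) from hsub (X.balSpan_le_span k hy)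
  rw [Submodule.span_le]
  rintro _ ⟨S, hS, rfl⟩
  show C.starC hV (X.eB.exteriorPower k S) ∈ X.balSpan l
  rw [C.starC_basis hV hlk S]
  refine Submodule.smul_mem _ _ ?_
  rw [basis_apply, ιMulti_family, ← mono_def]
  apply mono_mem_balSpan
  rw [X.bal_iff_balS _ (ofFinEmbEquiv.symm (compl hlk (X.barC S))).injective, image_ofFinEmbEquiv_symm]
  show X.BalS ((S.val.map X.barEmb)ᶜ)
  exact X.balS_compl (X.balS_map_bar hX.typ_bar hS) (X.balS_univ hX.typ_bar)

end ConjData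

end Obj

/-! ### 2. The model -/

/-- shorthand for the exterior CM-model -/
abbrev EM : Universe := toyModelWith exteriorHodgeData

/-- Finite products `prodFin` of CM objects are CM objects (induction on the number of factors). -/
theorem isCMObj_prodFin (D : HodgeData) : ∀ (n : ℕ) (X : Fin (n + 1) → Obj), (∀ j, (X j).IsCMObj) →
    Obj.IsCMObj ((toyModelWith D).prodFin n X)
  | 0, _, h => h 0
  | n + 1, _, h => Obj.isCMObj_prod (isCMObj_prodFin D n _ fun _ => h _) (h _)

/-- The CM products `cmProd F Θ'` of the toy model are CM objects. -/
theorem isCMObj_cmProd (D : HodgeData) (F : CMField) {n : ℕ} (Θ' : Fin (n + 1) → CMType F) :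
    Obj.IsCMObj ((toyModelWith D).cmProd F Θ') :=
  isCMObj_prodFin D n _ fun j => Obj.isCMObj_cmObj F (Θ' j)

/-- the four-fold CM product is the iterated product `cmProd` (definitionally) -/
theorem cmProd_eq_PP (D : HodgeData) (K : CMField) (Φ : Fin 4 → CMType K) :
    (toyModelWith D).cmProd K Φ = PP K Φ := rfl

/-- a face of the cyclotomic field `ℚ(ζ₇)` (`[ℚ(ζ₇) : ℚ] = 6`) -/
def f7 : Face cyclo7 := Classical.choice (exists_face cyclo7 (by rw [cyclo7_finrank]))

/-- `P7 = ∏ᵢ A_{(ℚ(ζ₇), Φᵢ)}` over the corner of the face `f7` -/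
abbrev P7 : Obj := PP cyclo7 f7.corner

/-- the balanced classes `Bal^{2p}(X)`, as a `B`-datum over the exterior CM-model -/
abbrev balB : (X : EM.Var) → (p : ℕ) → Submodule ℚ (EM.Coh X (2 * p)) := fun X p => Obj.balQ X (2 * p)

/-- the one extra CM variety -/
abbrev C7 : EM.Var → Prop := fun X => X = P7

/-- **The Lefschetz model**: the exterior CM-model with `Alg := Hdg ∩ Bal` and `P7` declared CM. -/
def lefModel : Universe := EM.balMod balB C7

section unfold

variable {X : Obj}

/-- `lefModel` is, by definition, `EM.balMod balB C7` (unfolding lemma). -/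
theorem lefModel_eq : lefModel = EM.balMod balB C7 := rfl

/-- The algebraic classes of `lefModel` are `Alg^p_{EM}(X) ⊓ Bal^{2p}(X)`. -/
theorem lef_alg_eq (X : Obj) (p : ℕ) : lefModel.alg X p = EM.alg X p ⊓ X.balQ (2 * p) := rfl

/-- Membership in the algebraic classes of `lefModel`: algebraic in the exterior CM-model and
balanced. -/
theorem mem_lef_alg {p : ℕ} (x : EM.Coh X (2 * p)) :
    x ∈ lefModel.alg X p ↔ x ∈ EM.alg X p ∧ X.Θ (2 * p) (ofRat x) ∈ X.balSpan (2 * p) :=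
  EM.mem_balMod_alg balB C7 x

/-- The Hodge classes of `lefModel` are those of the exterior CM-model `EM`. -/
theorem lef_hodgeClassesOf (X : Obj) (p : ℕ) : lefModel.hodgeClassesOf X p = EM.hodgeClassesOf X p := rfl

/-- The CM varieties of `lefModel` are the CM atoms `cmObj K Φ` and the extra variety `P7`. -/
theorem lef_isCM_iff (X : Obj) :
    lefModel.IsCMAbelianVariety X ↔ (∃ (K : CMField) (Φ : CMType K), X = cmObj K Φ) ∨ X = P7 := Iff.rfl

/-- Degree transport `castCoh` preserves membership in the rational balanced classes. -/
theorem castCoh_mem_balQ_iff (X : Obj) {k l : ℕ} (h : k = l) (z : EM.Coh X k) :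
    EM.castCoh X h z ∈ X.balQ l ↔ z ∈ X.balQ k := by
  subst h; exact Iff.rfl

end unfold

/-! ### 3. Closure properties of `Bal` (all at the level of `Obj` / `EM`) -/

namespace Obj

variable {X Y : Obj}

/-- `Bal` is preserved by pull-back along Hodge morphisms (`Obj.balSpan_map_le`). -/
theorem map_mem_balQ (f : Hom X Y) (k : ℕ) {w : ↥(⋀[ℚ]^k Y.L)} (hw : w ∈ Y.balQ k) :
    map k f.lin w ∈ X.balQ k := by
  rw [mem_balQ] at hw ⊢
  have e : (ofRat (map k f.lin w) : ℂ ⊗[ℚ] ↥(⋀[ℚ]^k X.L)) = (map k f.lin).baseChange ℂ (ofRat w) := by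
    rw [ofRat_apply, ofRat_apply, LinearMap.baseChange_tmul]
  have key : X.Θ k (ofRat (map k f.lin w)) = exteriorPower.map k (f.lin.baseChange ℂ) (Y.Θ k (ofRat w)) := by
    rw [e, BC.thetaEquiv_apply, BC.thetaEquiv_apply, BC.theta_naturality]
  rw [key]
  -- NB: no dot notation here — `Obj.balSpan_map_le` binds `{Y} {X}` (gen-5's `X.balSpan_map_le f …` sent the
  -- elaborator into a coercion search, reported as a `whnf` time-out).
  exact balSpan_map_le f k ⟨_, hw, rfl⟩

variable (X) in
/-- `Bal` is multiplicative: `Bal^i ∪ Bal^j ⊆ Bal^{i+j}` (`Obj.wedge_mem_balSpan`). -/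
theorem cup_mem_balQ (i j : ℕ) {x : ↥(⋀[ℚ]^i X.L)} {y : ↥(⋀[ℚ]^j X.L)} (hx : x ∈ X.balQ i)
    (hy : y ∈ X.balQ j) : EM.cup X i j x y ∈ X.balQ (i + j) := by
  rw [mem_balQ] at hx hy ⊢
  have e : (ofRat (EM.cup X i j x y) : EM.CohC X (i + j)) = EM.cupC X i j (ofRat x) (ofRat y) := by
    rw [ofRat_apply, ofRat_apply, ofRat_apply, Universe.cupC_tmul, mul_one]
  rw [e, theta_cupC]
  exact X.wedge_mem_balSpan i j hx hy

end Obj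

/-- M8-`B`: pull-back preserves `Bal`. -/
theorem bal_pull (X Y : Obj) (f : Obj.Hom X Y) (p : ℕ) :
    ((balB Y p).map (EM.pull f (2 * p))) ≤ balB X p := by
  rintro _ ⟨w, hw, rfl⟩
  exact Obj.map_mem_balQ f (2 * p) hw

/-- M9-`B`: the cup product of balanced degree-2 classes is balanced. -/
theorem bal_cup (X : Obj) (x y : EM.Coh X 2) (hx : x ∈ balB X 1) (hy : y ∈ balB X 1) :
    EM.cup X 2 2 x y ∈ balB X 2 :=
  X.cup_mem_balQ 2 2 hx hy

/-- M10-`B`: rational Hodge classes of degree 2 are balanced (`Obj.lefschetz11_bal`, `HodgeCM.Model.Toy.LefLefschetz`). -/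
theorem bal_lefschetz11 (X : Obj) : EM.hodgeClassesOf X 1 ≤ balB X 1 := fun x hx => X.lefschetz11_bal x hx

/-- F4-`B`: `Bal^{2p} ∪ Bal^{2q} ⊆ Bal^{2(p+q)}`. -/
theorem bal_cupAlg (X : Obj) (p q : ℕ) (x : EM.Coh X (2 * p)) (y : EM.Coh X (2 * q)) (hx : x ∈ balB X p)
    (hy : y ∈ balB X q) : EM.castCoh X (by omega) (EM.cup X (2 * p) (2 * q) x y) ∈ balB X (p + q) := by
  change EM.castCoh X _ (EM.cup X (2 * p) (2 * q) x y) ∈ X.balQ (2 * (p + q))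
  rw [castCoh_mem_balQ_iff]
  exact X.cup_mem_balQ _ _ hx hy

/-- M28-`B`: the Hodge star of a corner product preserves `Bal` (`Obj.ConjData.thetaLin_starQ_mem_balSpan`). -/
theorem starPP_map_balQ (K : CMField) (Φ : Fin 4 → CMType K) :
    ((PP K Φ).balQ (2 * (EM.dim (PP K Φ) - 2))).map (Star.starPP K Φ exteriorHodgeData) ≤ (PP K Φ).balQ 4 := by
  rw [Submodule.map_le_iff_le_comap]
  intro v hv
  have hv' : (PP K Φ).Θ _ ((1 : ℂ) ⊗ₜ[ℚ] v) ∈ (PP K Φ).balSpan (2 * (EM.dim (PP K Φ) - 2)) := hv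
  rw [Obj.theta_one_tmul] at hv'
  show (PP K Φ).Θ 4 ((1 : ℂ) ⊗ₜ[ℚ] (Star.starPP K Φ exteriorHodgeData v)) ∈ (PP K Φ).balSpan 4
  rw [Obj.theta_one_tmul]
  exact (Star.CP K Φ).thetaLin_starQ_mem_balSpan (Star.finrank_eq_PP K Φ exteriorHodgeData) (Obj.isCMObj_PP K Φ)
    (Star.card_Idx_PP K Φ exteriorHodgeData) hv'

/-! ### 4. M17, M26, M28 for `lefModel` -/

/-- **M17 for `lefModel`**: CM objects are dominated as in the toy model; `P7` is itself a CM product. -/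
theorem lef_cmDominated : lefModel.Fact_cmDominated :=
  Universe.balMod_fact_cmDominated (fact_cmDominated exteriorHodgeData galoisCMOracle) fun X hX => by
    have hX' : X = P7 := hX
    subst hX'
    refine ⟨cyclo7, cyclo7_isGalois, le_of_eq cyclo7_finrank.symm, 3, f7.corner, Obj.Hom.id _, Obj.Hom.id _, 1,
      one_ne_zero, fun k => ?_⟩
    change map k ((Obj.Hom.id P7).comp (Obj.Hom.id P7)).lin = _
    rw [Nat.cast_one, one_pow, one_smul]
    exact map_id

/-- **M26 for `lefModel`** (trace-free: Gysin class `0`). -/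
theorem lef_gysin_surface : lefModel.Fact_gysin_surface :=
  Universe.balMod_fact_gysin_surface fun _ _ => rfl

/-- **M28 for `lefModel`**: the Hodge star `D` of the toy model maps `Hdg ∩ Bal` to `Hdg ∩ Bal`. -/
theorem lef_algDuality : lefModel.Fact_algDuality := by
  intro K Φ
  refine ⟨Star.starPP K Φ exteriorHodgeData, Star.starPP_bijective K Φ exteriorHodgeData, ?_,
    fun a Ma Mb ha hb => Star.starPP_equivariance K Φ exteriorHodgeData a Ma Mb ha hb⟩
  change (EM.alg (PP K Φ) (EM.dim (PP K Φ) - 2) ⊓ (PP K Φ).balQ (2 * (EM.dim (PP K Φ) - 2))).map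
      (Star.starPP K Φ exteriorHodgeData) ≤ EM.alg (PP K Φ) 2 ⊓ (PP K Φ).balQ (2 * 2)
  exact le_inf ((Submodule.map_mono inf_le_left).trans (Star.starPP_alg K Φ))
    ((Submodule.map_mono inf_le_right).trans (starPP_map_balQ K Φ))

end HodgeCM.Toy

end
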